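import Mathlib
import Literature.Geometry.DiscreteGeometry.BondGraph
import Literature.MathematicalPhysics.StatisticalMechanics.HaggStacking
import Literature.MathematicalPhysics.StatisticalMechanics.BarlowStacking
import Literature.MathematicalPhysics.StatisticalMechanics.BarlowRings
import Literature.MathematicalPhysics.StatisticalMechanics.BarlowCoordination
import Summits.AtomisticToContinuum.Crystallization.Theorems.ShellsToBarlowChart.Negative.Calibration

/-!
# Route PricedLinkCensus — first-shell correspondence under an ideal Barlow chart (line Sketch of `StackingHinge`,
stmt-AtomisticToContinuum-14993; stub `stub_chartFirstShell`; lead c1)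

The conclusion of `SoftLayerPropagation` at a site `i` is a two-way `(nn_i/6)`-matching of the `3 nn_i`-window of `y i`
with a rigid image `g '' S` of the IDEAL stacking `S = barlowStacking nn_i (nn_i √(2/3)) s`.  This file reads the first
coordination shell off such a chart, under a local separation hypothesis (distinct sites within `3 nn_i` of `y i` are
`≥ nn_i/2` apart): there is a unique pattern point `z₀` within `nn_i/6` of `y i`; every TOUCHING point `z` of `z₀`
(`dist z₀ z = nn_i`; there are twelve, `ncard_touching_eq_twelve`) carries exactly one site `j ≠ i` within `nn_i/6`; and
every site `j ≠ i` with `dist (y i) (y j) ≤ (21/20) nn_i` — in particular every bond-graph neighbour of `i` at tolerance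
`≤ 1/20` — sits within `nn_i/6` of a touching point (the distance gap `(a, √2 a)` of the ideal stacking,
`eq_or_dist_eq_of_dist_lt`).  Letters (cubocta/anticubocta links) and local frames are read off this correspondence.

All `[folklore]`.
-/

namespace Summit.AtomisticToContinuum.Crystallization.Theorems.PricedHcpWindowsChartShell

open Literature.MathematicalPhysics.StatisticalMechanics
open Literature.Geometry.DiscreteGeometry

/-- **First-shell correspondence under an ideal Barlow chart** (see the module docstring). [folklore] -/
theorem stub_chartFirstShell : ∀ (N : ℕ) (y : Fin N → EuclideanSpace ℝ (Fin 3)) (i : Fin N) (s : ℤ → ℤ) (g : EuclideanSpace ℝ (Fin 3) ≃ᵃⁱ[ℝ] EuclideanSpace ℝ (Fin 3)), Literature.MathematicalPhysics.StatisticalMechanics.IsHaggSeq s → 0 < Literature.Geometry.DiscreteGeometry.nearestDist y i → (∀ j j' : Fin N, j ≠ j' → dist (y i) (y j) ≤ 3 * Literature.Geometry.DiscreteGeometry.nearestDist y i → dist (y i) (y j') ≤ 3 * Literature.Geometry.DiscreteGeometry.nearestDist y i → Literature.Geometry.DiscreteGeometry.nearestDist y i / 2 ≤ dist (y j) (y j'))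 → (∀ j : Fin N, dist (y i) (y j) ≤ 3 * Literature.Geometry.DiscreteGeometry.nearestDist y i → ∃ z ∈ Literature.MathematicalPhysics.StatisticalMechanics.barlowStacking (Literature.Geometry.DiscreteGeometry.nearestDist y i) (Literature.Geometry.DiscreteGeometry.nearestDist y i * Real.sqrt (2 / 3)) s, dist (y j) (g z) ≤ Literature.Geometry.DiscreteGeometry.nearestDist y i / 6) → (∀ z ∈ Literature.MathematicalPhysics.StatisticalMechanics.barlowStacking (Literature.Geometry.DiscreteGeometry.nearestDist y i) (Literature.Geometry.DiscreteGeometry.nearestDist y i * Real.sqrt (2 / 3)) s, dist (y i) (g z) ≤ 3 * Literature.Geometry.DiscreteGeometry.nearestDist y i → ∃ j : Fin N, dist (y j) (g z) ≤ Literature.Geometry.DiscreteGeometry.nearestDist y i / 6) → ∃ z₀ ∈ Literature.MathematicalPhysics.StatisticalMechanics.barlowStacking (Literature.Geometry.DiscreteGeometry.nearestDist y i) (Literature.Geometry.DiscreteGeometry.nearestDist y i * Real.sqrt (2 / 3)) s, dist (y i) (g z₀) ≤ Literature.Geometry.DiscreteGeometry.nearestDist y i / 6 ∧ (∀ z ∈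 Literature.MathematicalPhysics.StatisticalMechanics.barlowStacking (Literature.Geometry.DiscreteGeometry.nearestDist y i) (Literature.Geometry.DiscreteGeometry.nearestDist y i * Real.sqrt (2 / 3)) s, dist z₀ z = Literature.Geometry.DiscreteGeometry.nearestDist y i → ∃ j : Fin N, j ≠ i ∧ dist (y j) (g z) ≤ Literature.Geometry.DiscreteGeometry.nearestDist y i / 6 ∧ ∀ j' : Fin N, dist (y j') (g z) ≤ Literature.Geometry.DiscreteGeometry.nearestDist y i / 6 → j' = j) ∧ (∀ j : Fin N, j ≠ i → dist (y i) (y j) ≤ 21 / 20 * Literature.Geometry.DiscreteGeometry.nearestDist y i → ∃ z ∈ Literature.MathematicalPhysics.StatisticalMechanics.barlowStacking (Literature.Geometry.DiscreteGeometry.nearestDist y i) (Literature.Geometry.DiscreteGeometry.nearestDist y i * Real.sqrt (2 / 3)) s, dist z₀ z = Literature.Geometry.DiscreteGeometry.nearestDist y i ∧ dist (y j) (g z) ≤ Literature.Geometry.DiscreteGeometry.nearestDist y i / 6) := by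
  intro N y i s g hs hnn hsep h1 h2
  set nn : ℝ := nearestDist y i with hnn_def
  set S : Set (EuclideanSpace ℝ (Fin 3)) := barlowStacking nn (nn * Real.sqrt (2 / 3)) s with hS
  have hh : (nn * Real.sqrt (2 / 3)) ^ 2 = 2 / 3 * nn ^ 2 := ShellsToBarlowChartNegative.ideal_sq nn
  -- the base point
  obtain ⟨z₀, hz₀, hiz₀⟩ := h1 i (by rw [dist_self]; positivity)
  refine ⟨z₀, hz₀, hiz₀, ?_, ?_⟩
  · -- every touching point carries exactly one site
    intro z hz hzz
    have hgz : dist (g z₀) (g z) = nn := by rw [g.dist_map]; exact hzz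
    have hiz' : dist (y i) (g z) ≤ nn / 6 + nn :=
      (dist_triangle _ _ _).trans (add_le_add hiz₀ hgz.le)
    have hiz : dist (y i) (g z) ≤ 3 * nn := hiz'.trans (by linarith)
    obtain ⟨j, hj⟩ := h2 z hz hiz
    have hji : j ≠ i := by
      rintro rfl
      have : dist (g z₀) (g z) ≤ nn / 6 + nn / 6 :=
        (dist_triangle_left (g z₀) (g z) (y j)).trans (add_le_add hiz₀ hj)
      linarith
    refine ⟨j, hji, hj, fun j' hj' => ?_⟩
    by_contra hne
    have hclose : dist (y j) (y j') ≤ nn / 6 + nn / 6 :=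
      (dist_triangle_right (y j) (y j') (g z)).trans (add_le_add hj hj')
    have hij : dist (y i) (y j) ≤ 3 * nn :=
      (dist_triangle (y i) (g z) (y j)).trans (by rw [dist_comm (g z)]; linarith)
    have hij' : dist (y i) (y j') ≤ 3 * nn :=
      (dist_triangle (y i) (g z) (y j')).trans (by rw [dist_comm (g z)]; linarith)
    have := hsep j j' (Ne.symm hne) hij hij'
    linarith
  · -- every near site sits at a touching point
    intro j hji hij
    obtain ⟨z, hz, hjz⟩ := h1 j (by linarith)
    refine ⟨z, hz, ?_, hjz⟩
    have hlow : nn ≤ dist (y i) (y j) := nearestDist_le_dist y hji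
    have hgz : dist z₀ z = dist (g z₀) (g z) := (g.dist_map _ _).symm
    have hub : dist (g z₀) (g z) ≤ dist (y i) (y j) + (nn / 6 + nn / 6) := by
      calc dist (g z₀) (g z) ≤ dist (g z₀) (y i) + dist (y i) (y j) + dist (y j) (g z) := dist_triangle4 _ _ _ _
        _ ≤ nn / 6 + dist (y i) (y j) + nn / 6 := by rw [dist_comm (g z₀)]; gcongr
        _ = _ := by ring
    have hlb : dist (y i) (y j) ≤ dist (g z₀) (g z) + (nn / 6 + nn / 6) := by
      calc dist (y i) (y j) ≤ dist (y i) (g z₀) + dist (g z₀) (g z) + dist (g z) (y j) := dist_triangle4 _ _ _ _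
        _ ≤ nn / 6 + dist (g z₀) (g z) + nn / 6 := by rw [dist_comm (g z)]; gcongr
        _ = _ := by ring
    have hne : z₀ ≠ z := by
      intro heq
      rw [heq, dist_self] at hlb
      linarith
    have hlt : dist z₀ z < Real.sqrt 2 * nn := by
      have h2 : (1.4 : ℝ) < Real.sqrt 2 := by
        rw [show (1.4 : ℝ) = Real.sqrt (1.4 ^ 2) by rw [Real.sqrt_sq (by norm_num)]]
        exact Real.sqrt_lt_sqrt (by norm_num) (by norm_num)
      rw [hgz]
      nlinarith
    rcases eq_or_dist_eq_of_dist_lt hs hnn hh hz₀ hz hlt with h | h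
    · exact absurd h hne
    · exact h

end Summit.AtomisticToContinuum.Crystallization.Theorems.PricedHcpWindowsChartShell
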